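import Mathlib.Algebra.Polynomial.Taylor
import Mathlib.Algebra.Polynomial.HasseDeriv
import Mathlib.Algebra.Polynomial.Eval.Degree
import Mathlib.Algebra.CharP.Defs
import HarnessLib

/-!
# [OURS · L1 W4.6, rung (iv) «large characteristic»] The tame Tschirnhausen dichotomy: for a monic polynomial of degree
# `b`, the coefficient of `z^{b−1}` can be killed by a translation `z ↦ z + r` iff `b` is invertible; when `b = 0` in the
# ring (degree `p` in characteristic `p`) it is an INVARIANT of all translations
# (cell res-hironaka, LADDER-RESOLUTION rung L, D-0089; slot W4.6, seat res-L1-s46-pv-7; host route MarkedTransfer,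
# `--supports stmt-ResolutionOfSingularities-16155 --as helper`)

HONEST FRAMING. Nothing here is a statement of H. Hironaka's manuscript (2017-03-23, [Hironaka2017]) and nothing here
asserts that any statement of it holds. Mathlib-only one-variable algebra (`Polynomial.taylor`, `Polynomial.hasseDeriv`);
no premise of the manuscript, no FACT-LIST premise. AI review is weaker than expert review. No `sorry`, no definition;
axioms standard.

## Why (the boundary between regime (iv) «`p > b`» and regime (iii) «`z^p = f`, purely inseparable» of RESCUE-SEED W4.6)

Every characteristic-zero order-reduction for a hypersurface `z^b + a_1 z^{b−1} + ⋯ + a_b = 0` (Weierstrass form in a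
transversal coordinate `z` over the coefficient ring `R = 𝒪`) starts with the TSCHIRNHAUSEN translation
`z ↦ z − a_1 / b`, which kills the coefficient of `z^{b−1}` and produces the hypersurface of maximal contact `z = 0`.
This file isolates the arithmetic content of that step:

* `eval_hasseDeriv_pred_natDegree` — for `f` monic of degree `b ≥ 1`: `(D^{(b−1)} f)(r) = a_1 + b · r`
  (`a_1 = coeff_{b−1} f`), hence `coeff_taylor_pred_natDegree`: the `z^{b−1}`-coefficient of `f(z + r)` is `a_1 + b r`.
* `exists_taylor_coeff_pred_natDegree_eq_zero` — **TAME (`b` a unit of `R`, e.g. `p > b`)**: some translation kills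
  the `z^{b−1}`-term (`r = −a_1 / b`).
* `taylor_coeff_pred_natDegree_eq_of_natCast_eq_zero` — **WILD (`b = 0` in `R`, e.g. `b = p = char`)**: the
  `z^{b−1}`-coefficient is the same for EVERY translate `f(z + r)` — an invariant that no coordinate change of this kind
  removes (`not_exists_taylor_coeff_pred_natDegree_eq_zero`: if `a_1 ≠ 0` no translation kills it); in characteristic
  `p` with `b = p`: `taylor_coeff_pred_eq_of_charP`.

So for the first coordinate-change step of the classical procedure the honest threshold of regime (iv) is again the
ORDER: it works iff `b` is invertible in the local ring (for `0 < b < p`, always; at `b = p`, never by translations) —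
`C(n, d) = d` as for the tangent-cone steps (p481074, p483259, p486683), independent of the dimension.

## References (context; nothing is cited as a premise)

* The Tschirnhausen transformation / maximal contact in characteristic zero (e.g. Kollár, *Lectures on resolution of
  singularities*, §3.5); its failure in characteristic `p` for degree `p` (Cossart–Jannsen–Saito 2020, Introduction;
  Hauser 2010 §F). [cite: Kollar2007, §3.5] [cite: CossartJannsenSaito2020, §1]
-/

noncomputable section

set_option linter.dupNamespace false -- mandated namespace of this single-conjunct summit

namespace Summit.ResolutionOfSingularities.ResolutionOfSingularities.Theorems
namespace CampaignW46
namespace TameTschirnhausen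

open Polynomial

variable {R : Type*} [CommRing R]

/-- For `f` monic of degree `b ≥ 1`, the Hasse derivative `D^{(b−1)} f` is the linear polynomial `a_1 + b·X`
evaluated: `(D^{(b−1)} f)(r) = coeff_{b−1} f + b · r`. [folklore] -/
theorem eval_hasseDeriv_pred_natDegree {f : R[X]} (hf : f.Monic) {b : ℕ} (hb : f.natDegree = b) (hb1 : 1 ≤ b)
    (r : R) : (hasseDeriv (b - 1) f).eval r = f.coeff (b - 1) + (b : R) * r := by
  have hdeg : (hasseDeriv (b - 1) f).natDegree < 2 := by
    refine lt_of_le_of_lt (natDegree_hasseDeriv_le f (b - 1)) ?_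
    rw [hb]
    omega
  rw [eval_eq_sum_range' hdeg, Finset.sum_range_succ, Finset.sum_range_one, hasseDeriv_coeff, hasseDeriv_coeff,
    pow_zero, mul_one, pow_one, zero_add, Nat.choose_self, Nat.cast_one, one_mul,
    show 1 + (b - 1) = b by omega]
  have hlead : f.coeff b = 1 := by rw [← hb]; exact hf.coeff_natDegree
  have hchoose : b.choose (b - 1) = b := by rw [Nat.choose_symm hb1, Nat.choose_one_right]
  rw [hlead, mul_one, hchoose]

/-- **The `z^{b−1}`-coefficient of a translate**: for `f` monic of degree `b ≥ 1` and any `r`,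
`coeff_{b−1} f(z + r) = coeff_{b−1} f + b · r`. [folklore] -/
theorem coeff_taylor_pred_natDegree {f : R[X]} (hf : f.Monic) {b : ℕ} (hb : f.natDegree = b) (hb1 : 1 ≤ b) (r : R) :
    (taylor r f).coeff (b - 1) = f.coeff (b - 1) + (b : R) * r := by
  rw [taylor_coeff, eval_hasseDeriv_pred_natDegree hf hb hb1]

/-- [OURS · L1 W4.6 (iv); NOT a statement of the manuscript] **TAME TSCHIRNHAUSEN**: if `b` is a unit of `R` (e.g. the
degree is `< p` in a `ℤ_{(p)}`- or `𝔽_p`-algebra, or `R ⊇ ℚ`), the `z^{b−1}`-term of a monic `f` of degree `b` is killed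
by the translation `z ↦ z − coeff_{b−1} f / b`. [folklore] -/
theorem exists_taylor_coeff_pred_natDegree_eq_zero {f : R[X]} (hf : f.Monic) {b : ℕ} (hb : f.natDegree = b)
    (hunit : IsUnit (b : R)) : ∃ r : R, (taylor r f).coeff (b - 1) = 0 := by
  rcases Nat.eq_zero_or_pos b with hb0 | hb1
  · -- `b = 0`: `f = 1`, the coefficient in degree `b − 1 = 0` of any translate… is `1`; but then `(0 : R)` is a unit,
    -- so `R` is trivial and every equation holds.
    subst hb0
    have h01 : (0 : R) = 1 := by simpa using hunit
    exact ⟨0, by rw [← mul_one ((taylor 0 f).coeff (0 - 1)), ← h01, mul_zero]⟩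
  · obtain ⟨u, hu⟩ := hunit
    refine ⟨-(f.coeff (b - 1)) * ↑u⁻¹, ?_⟩
    rw [coeff_taylor_pred_natDegree hf hb hb1, ← hu]
    have h2 : (u : R) * (-(f.coeff (b - 1)) * ↑u⁻¹) = -(f.coeff (b - 1)) := by
      rw [← mul_assoc, mul_comm (u : R), mul_assoc, Units.mul_inv, mul_one]
    rw [h2, add_neg_cancel]

/-- [OURS · L1 W4.6 (iv); NOT a statement of the manuscript] **WILD: the `z^{b−1}`-coefficient is a translation
invariant when `b = 0` in `R`** (degree `b = p` in characteristic `p`, or any multiple of the characteristic): every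
translate `f(z + r)` of a monic `f` of degree `b ≥ 1` has the same coefficient of `z^{b−1}` as `f`. [folklore] -/
theorem taylor_coeff_pred_natDegree_eq_of_natCast_eq_zero {f : R[X]} (hf : f.Monic) {b : ℕ} (hb : f.natDegree = b)
    (hb1 : 1 ≤ b) (hzero : (b : R) = 0) (r : R) : (taylor r f).coeff (b - 1) = f.coeff (b - 1) := by
  rw [coeff_taylor_pred_natDegree hf hb hb1, hzero, zero_mul, add_zero]

/-- [OURS · L1 W4.6 (iv)] Consequently, when `b = 0` in `R` and `coeff_{b−1} f ≠ 0`, NO translation kills the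
`z^{b−1}`-term — the tame Tschirnhausen step is unavailable. [folklore] -/
theorem not_exists_taylor_coeff_pred_natDegree_eq_zero {f : R[X]} (hf : f.Monic) {b : ℕ} (hb : f.natDegree = b)
    (hb1 : 1 ≤ b) (hzero : (b : R) = 0) (ha : f.coeff (b - 1) ≠ 0) : ¬ ∃ r : R, (taylor r f).coeff (b - 1) = 0 := by
  rintro ⟨r, hr⟩
  rw [taylor_coeff_pred_natDegree_eq_of_natCast_eq_zero hf hb hb1 hzero] at hr
  exact ha hr

/-- [OURS · L1 W4.6 (iv)] **Characteristic `p`, degree `p`** (the purely inseparable boundary of regime (iii)): for a monic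
`f` of degree `p` over a ring of characteristic `p`, the `z^{p−1}`-coefficient of `f(z + r)` does not depend on `r`.
[folklore] -/
theorem taylor_coeff_pred_eq_of_charP (p : ℕ) [Fact p.Prime] [CharP R p] {f : R[X]} (hf : f.Monic)
    (hb : f.natDegree = p) (r : R) : (taylor r f).coeff (p - 1) = f.coeff (p - 1) :=
  taylor_coeff_pred_natDegree_eq_of_natCast_eq_zero hf hb (Fact.out : p.Prime).one_lt.le (CharP.cast_eq_zero R p) r

/-- [OURS · L1 W4.6 (iv)] **Characteristic `p`, degree `0 < b < p`** (regime (iv) for the Tschirnhausen step over a field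
or any algebra over a field of characteristic `p`): `b` is a unit, so the `z^{b−1}`-term can be killed. [folklore] -/
theorem exists_taylor_coeff_pred_natDegree_eq_zero_of_lt_char {K : Type*} [Field K] (p : ℕ) [CharP K p]
    [Algebra K R] {f : R[X]} (hf : f.Monic) {b : ℕ} (hb : f.natDegree = b) (hb0 : 0 < b) (hbp : b < p) :
    ∃ r : R, (taylor r f).coeff (b - 1) = 0 := by
  refine exists_taylor_coeff_pred_natDegree_eq_zero hf hb ?_
  have hK : (b : K) ≠ 0 := by
    rw [Ne, CharP.cast_eq_zero_iff K p b]
    exact fun hdvd => absurd (Nat.le_of_dvd hb0 hdvd) (by omega)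
  rw [← map_natCast (algebraMap K R)]
  exact (hK.isUnit).map _

end TameTschirnhausen
end CampaignW46
end Summit.ResolutionOfSingularities.ResolutionOfSingularities.Theorems

end
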